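import Summits.QuantumAdvantage.AdviceFreeQNC0.AffBells24ExposedSupport
import HarnessLib

/-!
# Sketch24 (planner qn-p1 g24, ROUND-23 §3.2; ask P-24a, third item): the EXPOSED-SUPPORT LEMMA ON A PARITY CLASS —
# `exposedSupportLemma : ExposedSupportLemma`, PROVED

`AffBells24.ExposedSupportLemma` (typed VERBATIM in `AffBells24ExposedSupport.lean`, from the planner's `exp24/Sketch24.lean`): an XOR
`F = ⊕_g [Σ_{e : y_e} γ_g(e) = c_g]` of MOD₃ tests on the cube `Fin Z → Bool` with an EXPOSED row `g₀` — support `S = supp γ_{g₀}` with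
`3 ≤ |S| ≤ Z − 1` and every other row missing `≥ 3` elements of `S` — is NOT constant on any parity class `{y : #ones(y) ≡ σ (mod 2)}`.

PROOF (the planner's `e₀`-elimination, ROUND-23 §3.2, made parity-only; prover seat qn-prover-3 g13).  Pick `e₀ ∉ S` (possible as
`|S| ≤ Z − 1`).  For `U ⊆ T ⊆ S` let `indP e₀ σ U` be the point of the parity class with ones exactly on `U`, except that the bit `e₀` is set
so that the weight is `≡ σ` (`indP_mem_parityClass`).  The class coefficient `coeffP e₀ σ T F := Σ_{U ⊆ T} F(indP U) mod 2` is additive over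
XOR (`coeffP_xorTests`) and vanishes for `T ≠ ∅` if `F` is constant on the class (`coeffP_const`).  For a row `g ≠ g₀` and `T ∈ {S, S ∖ e}`
there are two distinct points `e₁, e₂ ∈ T` outside `supp γ_g` (as `|S ∖ supp γ_g| ≥ 3` and `|S ∖ T| ≤ 1`); the substitution
`U ↦ U △ {e₁, e₂}` preserves BOTH the subset sum `Σ_U γ_g` AND the parity `|U|` (hence the bit `e₀`, which the row may read), so the row's
count over `T` is even (`card_filter_testP_even_two`, via the generic splitting `card_filter_powerset_insert` applied twice).  The row `g₀`
does not read `e₀` (`e₀ ∉ S`), so its count is `nSub T γ_{g₀} c_{g₀}` and `nSub_mod_two` (part 1) gives `c + Σ_S γ = 0 = c + Σ_{S∖e} γ`,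
i.e. `γ_{g₀}(e) = 0` for `e ∈ S` — absurd.  COROLLARY (planner): a perfect affine MOD₃ bell strategy has NO exposed active row on ANY fibre.
WHAT THIS IS NOT: `FullSupportRigidity` (full-support rows, conjectural) is untouched; instrument for the (NP₀) rung of plan S2 / crux
stmt-QuantumAdvantage-22907 (route DWalkThree); no 99 %-regime bound; separation NOT moved.
-/

namespace Summit.QuantumAdvantage.AdviceFreeQNC0

namespace AffBells24

open Finset

variable {Z : ℕ}

/-! ### Generic splitting of a filtered power set along one element -/

/-- `#{U ⊆ insert a S : P U} = #{U ⊆ S : P U} + #{U ⊆ S : P (insert a U)}` for `a ∉ S`. -/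
theorem card_filter_powerset_insert {a : Fin Z} {S : Finset (Fin Z)} (ha : a ∉ S) (f : Finset (Fin Z) → Bool) :
    ((insert a S).powerset.filter fun U => f U = true).card =
      (S.powerset.filter fun U => f U = true).card + (S.powerset.filter fun U => f (insert a U) = true).card := by
  classical
  rw [Finset.powerset_insert, Finset.filter_union, Finset.card_union_of_disjoint]
  · congr 1
    rw [Finset.filter_image, Finset.card_image_of_injOn]
    · intro U hU U' hU' h
      rw [mem_coe, mem_filter, mem_powerset] at hU hU'
      have haU : a ∉ U := fun hh => ha (hU.1 hh)
      have haU' : a ∉ U' := fun hh => ha (hU'.1 hh)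
      rw [← Finset.erase_insert haU, ← Finset.erase_insert haU', h]
  · rw [Finset.disjoint_left]
    intro U hU hU'
    rw [mem_filter, mem_powerset] at hU
    rw [mem_filter, Finset.mem_image] at hU'
    obtain ⟨U', _, rfl⟩ := hU'.1
    exact ha (hU.1 (mem_insert_self a U'))

/-! ### Points of a parity class above a sub-cube avoiding `e₀` -/

/-- The point of the parity class `σ` with ones exactly on `U` off `e₀`, the bit `e₀` being set so that the weight is `≡ σ (mod 2)`. -/
def indP (e₀ : Fin Z) (σ : ℕ) (U : Finset (Fin Z)) : Fin Z → Bool :=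
  fun e => if e = e₀ then decide (U.card % 2 ≠ σ % 2) else decide (e ∈ U)

/-- The ones of `indP e₀ σ U` off `e₀` are exactly `U` (for `e₀ ∉ U`). -/
theorem filter_indP_eq (e₀ : Fin Z) (σ : ℕ) {U : Finset (Fin Z)} (hU : e₀ ∉ U) :
    (univ.filter fun e => indP e₀ σ U e = true) =
      if U.card % 2 ≠ σ % 2 then insert e₀ U else U := by
  ext e
  simp only [mem_filter, mem_univ, true_and, indP]
  by_cases he : e = e₀
  · subst he
    simp only [if_true, decide_eq_true_eq]
    split_ifs with h
    · simp [h]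
    · simp [h, hU]
  · rw [if_neg he, decide_eq_true_eq]
    split_ifs with h
    · rw [mem_insert, or_iff_right he]
    · rfl

/-- `indP e₀ σ U` lies in the parity class `σ` (for `e₀ ∉ U`). -/
theorem indP_mem_parityClass (e₀ : Fin Z) (σ : ℕ) {U : Finset (Fin Z)} (hU : e₀ ∉ U) :
    indP e₀ σ U ∈ parityClass Z σ := by
  unfold parityClass
  rw [mem_filter, filter_indP_eq e₀ σ hU]
  refine ⟨mem_univ _, ?_⟩
  split_ifs with h
  · rw [card_insert_of_notMem hU]; omega
  · omega

/-- A test at `indP e₀ σ U`: the subset sum over `U`, plus `γ e₀` if the parity bit is set. -/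
theorem test_indP (γ : Fin Z → ZMod 3) (c : ZMod 3) (e₀ : Fin Z) (σ : ℕ) {U : Finset (Fin Z)} (hU : e₀ ∉ U) :
    test γ c (indP e₀ σ U) =
      decide ((∑ e ∈ U, γ e) + (if U.card % 2 ≠ σ % 2 then γ e₀ else 0) = c) := by
  classical
  unfold test
  have hsum : (∑ e : Fin Z, if indP e₀ σ U e = true then γ e else 0) =
      ∑ e ∈ univ.filter (fun e => indP e₀ σ U e = true), γ e := (Finset.sum_filter _ _).symm
  rw [hsum, filter_indP_eq e₀ σ hU]
  split_ifs with h
  · rw [Finset.sum_insert hU, add_comm]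
  · rw [add_zero]

/-- A test that does not read `e₀` sees only the subset sum. -/
theorem test_indP_of_zero {γ : Fin Z → ZMod 3} (c : ZMod 3) {e₀ : Fin Z} (hγ : γ e₀ = 0) (σ : ℕ) {U : Finset (Fin Z)}
    (hU : e₀ ∉ U) : test γ c (indP e₀ σ U) = decide ((∑ e ∈ U, γ e) = c) := by
  rw [test_indP γ c e₀ σ hU, hγ]
  simp

/-! ### Class coefficients -/

/-- The class coefficient of the monomial `y_T`: parity of `Σ_{U ⊆ T} F(indP U)`. -/
def coeffP (e₀ : Fin Z) (σ : ℕ) (T : Finset (Fin Z)) (F : (Fin Z → Bool) → Bool) : ℕ :=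
  (T.powerset.filter fun U => F (indP e₀ σ U) = true).card % 2

/-- Functions constant on the parity class have no non-empty class monomials (for `e₀ ∉ T`). -/
theorem coeffP_const {σ : ℕ} {F : (Fin Z → Bool) → Bool} {b : Bool} (hF : ∀ y ∈ parityClass Z σ, F y = b)
    {e₀ : Fin Z} {T : Finset (Fin Z)} (he₀ : e₀ ∉ T) (hT : T.Nonempty) : coeffP e₀ σ T F = 0 := by
  unfold coeffP
  obtain ⟨k, hk⟩ : ∃ k, T.card = k + 1 := ⟨T.card - 1, by have := hT.card_pos; omega⟩
  have hval : ∀ U ∈ T.powerset, F (indP e₀ σ U) = b := fun U hU =>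
    hF _ (indP_mem_parityClass e₀ σ fun h => he₀ (mem_powerset.1 hU h))
  cases b
  · rw [Finset.filter_false_of_mem (fun U hU => by rw [hval U hU]; decide), card_empty]
  · rw [Finset.filter_true_of_mem (fun U hU => hval U hU), Finset.card_powerset, hk, pow_succ]
    exact Nat.mul_mod_left _ _

/-- Parity of the number of odd counts = parity of the total count. -/
private theorem card_filter_odd_mod_two'' {ι : Type*} (s : Finset ι) (cnt : ι → ℕ) :
    (s.filter fun j => cnt j % 2 = 1).card % 2 = (∑ j ∈ s, cnt j) % 2 := by
  rw [Finset.sum_nat_mod, Finset.card_filter]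
  congr 1
  refine Finset.sum_congr rfl fun j _ => ?_
  rcases Nat.mod_two_eq_zero_or_one (cnt j) with h | h <;> simp [h]

/-- **Additivity over XOR** for class coefficients. -/
theorem coeffP_xorTests {K : ℕ} (γ : Fin K → Fin Z → ZMod 3) (c : Fin K → ZMod 3) (e₀ : Fin Z) (σ : ℕ)
    (T : Finset (Fin Z)) :
    coeffP e₀ σ T (xorTests γ c) =
      (∑ g : Fin K, (T.powerset.filter fun U => test (γ g) (c g) (indP e₀ σ U) = true).card) % 2 := by
  unfold coeffP
  have e1 : (T.powerset.filter fun U => xorTests γ c (indP e₀ σ U) = true) =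
      T.powerset.filter fun U => (univ.filter fun g => test (γ g) (c g) (indP e₀ σ U) = true).card % 2 = 1 := by
    refine filter_congr fun U _ => ?_
    unfold xorTests
    rw [decide_eq_true_eq]
  rw [e1, card_filter_odd_mod_two'']
  congr 1
  simp_rw [Finset.card_filter]
  exact Finset.sum_comm

/-- **A row missing two points `e₁ ≠ e₂` of `T` has even count on the class sub-cube of `T`**: the substitution `U ↦ U △ {e₁,e₂}`
preserves the subset sum and the parity of `|U|`, hence the test value (even if the row reads `e₀`). -/
theorem card_filter_testP_even_two (γ : Fin Z → ZMod 3) (c : ZMod 3) (e₀ : Fin Z) (σ : ℕ) {T : Finset (Fin Z)}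
    (he₀ : e₀ ∉ T) {e₁ e₂ : Fin Z} (h₁ : e₁ ∈ T) (h₂ : e₂ ∈ T) (hne : e₁ ≠ e₂) (hγ₁ : γ e₁ = 0) (hγ₂ : γ e₂ = 0) :
    (T.powerset.filter fun U => test γ c (indP e₀ σ U) = true).card % 2 = 0 := by
  classical
  -- peel off `e₁` and `e₂`
  set T' := (T.erase e₁).erase e₂ with hT'
  have h₂' : e₂ ∈ T.erase e₁ := mem_erase.2 ⟨hne.symm, h₂⟩
  have hT : T = insert e₁ (insert e₂ T') := by
    rw [hT', insert_erase h₂', insert_erase h₁]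
  have he₂T' : e₂ ∉ T' := notMem_erase e₂ _
  have he₁T'' : e₁ ∉ insert e₂ T' := by
    rw [mem_insert, not_or]
    exact ⟨hne, fun h => (notMem_erase e₁ T) (mem_of_mem_erase h)⟩
  have he₁T' : e₁ ∉ T' := fun h => he₁T'' (mem_insert_of_mem h)
  have he₀T' : ∀ U ⊆ T', e₀ ∉ U ∧ e₁ ∉ U ∧ e₂ ∉ U := fun U hU =>
    ⟨fun h => he₀ (by rw [hT]; exact mem_insert_of_mem (mem_insert_of_mem (hU h))),
      fun h => he₁T' (hU h), fun h => he₂T' (hU h)⟩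
  have he₀₁ : e₀ ≠ e₁ := fun h => he₀ (h ▸ h₁)
  have he₀₂ : e₀ ≠ e₂ := fun h => he₀ (h ▸ h₂)
  -- the test value depends on `U` only through the subset sum and `|U| mod 2`
  have hval : ∀ V W : Finset (Fin Z), e₀ ∉ V → e₀ ∉ W → (∑ e ∈ V, γ e) = ∑ e ∈ W, γ e →
      V.card % 2 = W.card % 2 → test γ c (indP e₀ σ V) = test γ c (indP e₀ σ W) := by
    intro V W hV hW hs hc
    rw [test_indP γ c e₀ σ hV, test_indP γ c e₀ σ hW, hs, hc]
  rw [hT, card_filter_powerset_insert he₁T'', card_filter_powerset_insert he₂T',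
    card_filter_powerset_insert he₂T']
  -- the four counts pair up
  have hA : (T'.powerset.filter fun U => test γ c (indP e₀ σ (insert e₁ U)) = true) =
      T'.powerset.filter fun U => test γ c (indP e₀ σ (insert e₂ U)) = true := by
    refine filter_congr fun U hU => ?_
    rw [mem_powerset] at hU
    obtain ⟨h0, h1, h2⟩ := he₀T' U hU
    rw [hval (insert e₁ U) (insert e₂ U) (by rw [mem_insert, not_or]; exact ⟨he₀₁, h0⟩)
        (by rw [mem_insert, not_or]; exact ⟨he₀₂, h0⟩)
        (by rw [sum_insert h1, sum_insert h2, hγ₁, hγ₂])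
        (by rw [card_insert_of_notMem h1, card_insert_of_notMem h2])]
  have hB : (T'.powerset.filter fun U => test γ c (indP e₀ σ (insert e₁ (insert e₂ U))) = true) =
      T'.powerset.filter fun U => test γ c (indP e₀ σ U) = true := by
    refine filter_congr fun U hU => ?_
    rw [mem_powerset] at hU
    obtain ⟨h0, h1, h2⟩ := he₀T' U hU
    have h1' : e₁ ∉ insert e₂ U := by rw [mem_insert, not_or]; exact ⟨hne, h1⟩
    rw [hval (insert e₁ (insert e₂ U)) U
        (by rw [mem_insert, not_or, mem_insert, not_or]; exact ⟨he₀₁, he₀₂, h0⟩) h0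
        (by rw [sum_insert h1', sum_insert h2, hγ₁, hγ₂, zero_add, zero_add])
        (by rw [card_insert_of_notMem h1', card_insert_of_notMem h2]; omega)]
  rw [hA, hB]
  omega

/-! ### The exposed-support lemma on a parity class -/

/-- **`ExposedSupportLemma` — PROVED.** -/
theorem exposedSupportLemma : ExposedSupportLemma := by
  intro Z K σ γ c g₀ hexp b
  classical
  obtain ⟨hS3, hSZ, hmiss⟩ := hexp
  by_contra hcon
  push Not at hcon
  set S := supp (γ g₀) with hSdef
  have hγS : ∀ x ∈ S, γ g₀ x ≠ 0 := fun x hx => (mem_filter.1 hx).2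
  -- a coin outside the support
  obtain ⟨e₀, he₀⟩ : ∃ e₀, e₀ ∉ S := by
    by_contra h
    push Not at h
    have : S = univ := eq_univ_of_forall h
    rw [this, card_univ, Fintype.card_fin] at hSZ
    omega
  have hγe₀ : γ g₀ e₀ = 0 := by
    by_contra h
    exact he₀ (mem_filter.2 ⟨mem_univ _, h⟩)
  obtain ⟨e, he⟩ : S.Nonempty := card_pos.1 (by omega)
  -- on the class sub-cubes of `T = S` and `T = S ∖ e` only the row `g₀` counts
  have key : ∀ T : Finset (Fin Z), T ⊆ S → T.Nonempty → S.card ≤ T.card + 1 →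
      nSub T (γ g₀) (c g₀) % 2 = 0 := by
    intro T hTS hTne hTcard
    have he₀T : e₀ ∉ T := fun h => he₀ (hTS h)
    have h0 : coeffP e₀ σ T (xorTests γ c) = 0 := coeffP_const hcon he₀T hTne
    rw [coeffP_xorTests] at h0
    have hothers : ∀ g, g ≠ g₀ →
        (T.powerset.filter fun U => test (γ g) (c g) (indP e₀ σ U) = true).card % 2 = 0 := by
      intro g hg
      -- two points of `T` outside the support of row `g`
      have h2 : 1 < (T \ supp (γ g)).card := by
        have hsub : S \ supp (γ g) ⊆ (T \ supp (γ g)) ∪ (S \ T) := by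
          intro x hx
          rw [mem_sdiff] at hx
          rw [mem_union, mem_sdiff, mem_sdiff]
          by_cases hxT : x ∈ T
          · exact Or.inl ⟨hxT, hx.2⟩
          · exact Or.inr ⟨hx.1, hxT⟩
        have h1 := (card_le_card hsub).trans (card_union_le _ _)
        rw [card_sdiff_of_subset hTS] at h1
        have h3 := hmiss g hg
        omega
      obtain ⟨e₁, he₁, e₂, he₂, hne⟩ := Finset.one_lt_card.1 h2
      rw [mem_sdiff] at he₁ he₂
      have hγ₁ : γ g e₁ = 0 := by by_contra h; exact he₁.2 (mem_filter.2 ⟨mem_univ _, h⟩)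
      have hγ₂ : γ g e₂ = 0 := by by_contra h; exact he₂.2 (mem_filter.2 ⟨mem_univ _, h⟩)
      exact card_filter_testP_even_two (γ g) (c g) e₀ σ he₀T he₁.1 he₂.1 hne hγ₁ hγ₂
    have hmain : (T.powerset.filter fun U => test (γ g₀) (c g₀) (indP e₀ σ U) = true).card =
        nSub T (γ g₀) (c g₀) := by
      unfold nSub
      congr 1
      refine filter_congr fun U hU => ?_
      rw [test_indP_of_zero (c g₀) hγe₀ σ (fun h => he₀T (mem_powerset.1 hU h)), decide_eq_true_eq]
    rw [← Finset.add_sum_erase univ _ (mem_univ g₀), Nat.add_mod, Finset.sum_nat_mod,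
      Finset.sum_eq_zero (fun g hg => hothers g (Finset.ne_of_mem_erase hg)), Nat.zero_mod, add_zero,
      Nat.mod_mod, hmain] at h0
    exact h0
  have h1 := key S subset_rfl ⟨e, he⟩ (by omega)
  have h2 := key (S.erase e) (erase_subset _ _)
    (by rw [← card_pos, card_erase_of_mem he]; omega) (by rw [card_erase_of_mem he]; omega)
  rw [nSub_mod_two S ⟨e, he⟩ (γ g₀) hγS] at h1
  rw [nSub_mod_two (S.erase e) (by rw [← card_pos, card_erase_of_mem he]; omega) (γ g₀)
    (fun x hx => hγS x (mem_of_mem_erase hx))] at h2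
  have h1' : c g₀ + ∑ x ∈ S, γ g₀ x = 0 := by
    by_contra h; rw [if_pos h] at h1; exact absurd h1 (by decide)
  have h2' : c g₀ + ∑ x ∈ S.erase e, γ g₀ x = 0 := by
    by_contra h; rw [if_pos h] at h2; exact absurd h2 (by decide)
  have hsum : (∑ x ∈ S, γ g₀ x) = γ g₀ e + ∑ x ∈ S.erase e, γ g₀ x := (Finset.add_sum_erase S _ he).symm
  have hγe : γ g₀ e = 0 := by
    rw [hsum] at h1'
    linear_combination h1' - h2'
  exact hγS e he hγe

end AffBells24

end Summit.QuantumAdvantage.AdviceFreeQNC0
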